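import Summits.CriticalPhenomena.CardyFormulaZ2.Theorems.CardyBoundaryCoulombGasHalfPlaneMarkDensityLawGapNotCrossErase
import Summits.CriticalPhenomena.CardyFormulaZ2.Theorems.CardyBoundaryCoulombGasHalfPlaneMarkDensityLawGapArmOfLeggedPath
import Summits.CriticalPhenomena.CardyFormulaZ2.Theorems.CardyBoundaryCoulombGasHalfPlaneMarkDensityLawGapOneArmOfNotCross
import Summits.CriticalPhenomena.CardyFormulaZ2.Theorems.CardyBoundaryCoulombGasHalfPlaneMarkDensityLawGapOneSubCrossingLe
import Summits.CriticalPhenomena.CardyFormulaZ2.Theorems.CardyBoundaryCoulombGasHalfPlaneMarkDensityLawGapEventuallyGe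
import Summits.CriticalPhenomena.CardyFormulaZ2.Theorems.CardyBoundaryCoulombGasHalfPlaneMarkDensityLawGapTendstoOne

/-!
# `HalfPlaneMarkDensityLaw` (crux stmt-CriticalPhenomena-5661), line `Sketch`, cycle 2 (`GapClose`), lead c12-0:
# assembly — **joint subsequential limits of the half-plane four-arc crossing probability tend to `1`
# as the gap closes**

`P_n(a,b,c,y) = P_{1/2}[[⌊an⌋,⌊bn⌋]×{0} ↔ [⌊cn⌋,⌊yn⌋]×{0} in ℤ×ℕ]`.  Composition of the landed stubs of
the cycle-2 skeleton `Lines/Sketch_GapClose.lean`: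

* `stub_oneArm_of_notCross` (deterministic) — a lattice configuration with bounded arc-cluster that does
  NOT join `[α',−S]×{0}` to `[1,X]×{0}` inside `H` has one closed arm from the moat under the gap window
  `[−S,1)` to sup-distance `R ≤ min X (−S−α'+1)` (edge erasure left of the source arc +
  `SelfDual.dual_of_not_primal` + truncation: `stub_notCross_erase`, `stub_dualStep_erase`,
  `stub_armOfLeggedPath`, glued by `stub_oneArm_of_notCross_of`);
* `stub_one_sub_crossing_le` — **`1 − P[[α',β] ↔ [γ,δ] in H] ≤ C₁((γ−β)/R)^α`** for
  `K₁(γ−β) ≤ R ≤ min (δ−γ+1) (β−α'+1)` (a.s. finiteness of clusters `SelfDual.ae_bounded_joined`, the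
  one-arm bound `Z2HalfPlane.real_oneArm_le`, exact translation `Subseq.crossing_shift`);
* `stub_eventually_ge_one_sub` — `P_n(a,b,c,y) ≥ 1 − C₁(2(c−b)/d)^α` eventually, `K(c−b) < d ≤ min (b−a) (y−c)`;
* `stub_jointLimit_tendsto_one` — for every joint subsequential limit `G` (c2-0's
  `Subseq.exists_jointSubseqLimit`) and `a < b < y`: **`G(a,b,c,y) → 1` as `c ↓ b`**.

With c2-0's vanishing at `η = 0` and this seat's `stub_jointLimit_lt_one` / strict monotonicity, every
joint subsequential limit is a strictly monotone continuous surjection of each mark interval onto its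
range inside `(0,1)`, with the correct boundary values `0` and `1` at the two ends of the gap variable.
-/

noncomputable section

namespace Summit.CriticalPhenomena.CardyFormulaZ2.Cruxes.HalfPlaneMarkDensityLaw.SketchLine

open Literature.Probability.Percolation Literature.Probability.LatticeModels
open Literature.Probability.Percolation.Z2HalfPlane (leg Far faceBox oneArm)
open MeasureTheory Filter Set SimpleGraph
open scoped Topology
open Summit.CriticalPhenomena.CardyFormulaZ2.Theorems.HalfPlaneMarkDensityLaw.Negative

namespace GapClose

/-- **G4.** Not joining `[α',−S]×{0}` to `[1,X]×{0}` inside `H` (bounded arc-cluster) forces one closed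
arm of `ω` from the moat under the gap window `[−S,1)` to sup-distance `R`. [folklore] -/
theorem stub_oneArm_of_notCross :
    ∀ (ω : BondConfig (Site 2)) (α' S X : ℤ) (R N : ℕ), α' ≤ -S → 0 ≤ S → 1 ≤ X → (∀ y : Site 2, (∃ r ∈ rowIcc 1 X, ω ∈ openConnIn halfPlane r y) → |y 0| ≤ N ∧ y 1 ≤ N) → ω ∉ openCrossing halfPlane (rowIcc α' (-S)) (rowIcc 1 X) → (R : ℤ) ≤ X → (R : ℤ) ≤ -S - α' + 1 → ω ∈ oneArm (-S) (S.toNat + 1) R :=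
  stub_oneArm_of_notCross_of stub_notCross_erase stub_armOfLeggedPath

/-- **G5. `1 − P[[α',β] ↔ [γ,δ] in H] ≤ C₁((γ−β)/R)^α`** for `K₁(γ−β) ≤ R ≤ min (δ−γ+1) (β−α'+1)`.
[folklore] -/
theorem stub_one_sub_crossing_le :
    ∃ C₁ α : ℝ, 0 < C₁ ∧ 0 < α ∧ ∃ K₁ : ℕ, 1 ≤ K₁ ∧ ∀ (α' β γ δ : ℤ) (R : ℕ), α' ≤ β → β < γ → γ ≤ δ → (K₁ : ℤ) * (γ - β) ≤ R → (R : ℤ) ≤ δ - γ + 1 → (R : ℤ) ≤ β - α' + 1 → 1 - C₁ * (((γ : ℝ) - β) / R) ^ α ≤ μ.real (openCrossing halfPlane (rowIcc α' β) (rowIcc γ δ)) :=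
  stub_one_sub_crossing_le_of stub_oneArm_of_notCross

/-- **G6. `P_n(a,b,c,y) ≥ 1 − C₁(2(c−b)/d)^α` eventually**, for `K(c−b) < d ≤ min (b−a) (y−c)`. [folklore] -/
theorem stub_eventually_ge_one_sub :
    ∃ C₁ α K : ℝ, 0 < C₁ ∧ 0 < α ∧ 0 < K ∧ ∀ (a b c y d : ℝ), a < b → b < c → c < y → K * (c - b) < d → d ≤ b - a → d ≤ y - c → ∀ᶠ n : ℕ in atTop, 1 - C₁ * (2 * (c - b) / d) ^ α ≤ μ.real (openCrossing halfPlane (arcA a b n) (rowIcc ⌊c * n⌋ ⌊y * n⌋)) :=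
  stub_eventually_ge_one_sub_of stub_one_sub_crossing_le

/-- **G7. Every joint subsequential scaling limit of the half-plane four-arc crossing probability of
critical bond percolation on `ℤ²` tends to `1` as the gap between the arcs closes**: for `a < b < y`,
`G(a,b,c,y) → 1` as `c ↓ b`. [folklore] -/
theorem stub_jointLimit_tendsto_one :
    ∀ {θ : ℕ → ℕ} {G : ℝ → ℝ → ℝ → ℝ → ℝ}, (∀ a b c y : ℝ, a < b → b < c → c < y → Tendsto (fun n ↦ μ.real (openCrossing halfPlane (arcA a b (θ n)) (rowIcc ⌊c * (θ n : ℕ)⌋ ⌊y * (θ n : ℕ)⌋))) atTop (𝓝 (G a b c y))) → StrictMono θ → ∀ {a b y : ℝ}, a < b → b < y → Tendsto (fun c ↦ G a b c y) (𝓝[>] b) (𝓝 1) :=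
  stub_jointLimit_tendsto_one_of stub_eventually_ge_one_sub

end GapClose

end Summit.CriticalPhenomena.CardyFormulaZ2.Cruxes.HalfPlaneMarkDensityLaw.SketchLine
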